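import Summits.CriticalPhenomena.SAWScalingLimit.Theorems.SAWTensorRGRestrictionOfLimitRadoFamilyA
import Summits.CriticalPhenomena.SAWScalingLimit.Theorems.SAWTensorRGRestrictionOfLimitSqueezeChart
import Summits.CriticalPhenomena.SAWScalingLimit.Theorems.SAWTensorRGRestrictionOfLimitRadoUniformizers
import Literature.Probability.RandomPlanarGeometry.CurveSpace
import Mathlib.Data.Rat.Denumerable
import HarnessLib

/-!
# Radó squeezes, part 13: exhaustion, uniform convergence of the boundary loops, and the registered stub

Support file (`--supports stmt-CriticalPhenomena-0773`) LANDING the registered stub `stub_radoSqueezeFamily`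
(geometry F′ of composition 3 of the line `birth` for the crux `RestrictionOfLimit`, shared verbatim by the routes
SAWConePseudogroup / SAWConfRestriction / SAWBrownianDomination / SAWTowerCount / SAWTensorRG). Pure plane
topology plus Radó's theorem (through part 0, `exists_discUniformizers_of_tendstoUniformly_boundary`).

For the family `levelE` of part 12 we prove EXHAUSTION (a point in `closure (levelE t)` for all `t > 0` lies in
`closure D'`: a point of `D ∖ closure D'` lies in a defect side, treated and bitten away at small `t`; a point of
`∂D ∖ closure D'` is handled through a closed half-plane chart of `D`, near which `D` is connected, which places
it on the open arc `β` of a defect side) and UNIFORM CONVERGENCE of the boundary loops `loopγ t (treated t)` to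
`D'.boundary` as `t → 0⁺` (finitely many large defect sides, each treated for small `t` with its chart uniformly
continuous and the collar path `6t`-close to the base; all other sides are small). With part 0 this proves
`stub_radoSqueezeFamily`.

References: T. Radó (1923); Ch. Pommerenke, *Boundary Behaviour of Conformal Maps* (1992), Thm. 2.11;
M. H. A. Newman (1939), Ch. V §11. Axioms `propext`, `Classical.choice`, `Quot.sound`.
-/

noncomputable section

open Set Filter Topology Metric Complex
open Literature.Topology.PlaneTopology Literature.Probability.RandomPlanarGeometry
open scoped Classical

namespace Summit.CriticalPhenomena.SAWScalingLimit.Theorems.RestrictionOfLimit.Birth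

section FamilyB

variable {D D' : DobrushinDomain} {F : Set ℝ} (xs : ℕ → ℝ)
  (d : ∀ n : ℕ, xs n ∈ F ∧ xs n ∈ Ioo (D'.mark 0) (D'.mark 0 + 1) → DefectData D D' F (xs n))
  (hex : ∀ y : ℝ, y ∈ F ∧ y ∈ Ioo (D'.mark 0) (D'.mark 0 + 1) →
    ∃ n : ℕ, (xs n ∈ F ∧ xs n ∈ Ioo (D'.mark 0) (D'.mark 0 + 1)) ∧ xs n ∈ connectedComponentIn F y)
  (hF : F = {θ : ℝ | D'.boundary θ ∈ D.carrier}) (hsub : D'.carrier ⊆ D.carrier)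
  (h0 : D'.pt 0 = D.pt 0) (h1 : D'.pt 1 = D.pt 1)

/-! ### Exhaustion -/

include hex hF hsub h0 h1 in
/-- **Locating a point off `closure D'` in the closure of a defect side of a representative**, as the chart
image of a model point of positive height. [folklore] -/
theorem exists_rep_of_notMem_closure {w : ℂ} (hwD : w ∈ closure D.carrier) (hwcl : w ∉ closure D'.carrier) :
    ∃ (n : ℕ) (hn : (xs n ∈ F ∧ xs n ∈ Ioo (D'.mark 0) (D'.mark 0 + 1)) ∧
        ∀ k < n, xs k ∈ F ∧ xs k ∈ Ioo (D'.mark 0) (D'.mark 0 + 1) →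
          connectedComponentIn F (xs k) ≠ connectedComponentIn F (xs n)) (z : ℂ),
      ‖z‖ ≤ 1 ∧ 0 < z.im ∧ (d n hn.1).G z = w := by
  -- a connected subset `N ⊆ D ∖ closure D'` with `w ∈ closure N`
  obtain ⟨N, hNc, hNsub, hwN⟩ : ∃ N : Set ℂ, IsPreconnected N ∧ N ⊆ D.carrier \ closure D'.carrier ∧
      w ∈ closure N ∧ N.Nonempty := by
    by_cases hwD' : w ∈ D.carrier
    · exact ⟨{w}, isPreconnected_singleton, by simpa using And.intro hwD' hwcl, by simp, by simp⟩
    · -- boundary point: use a closed half-plane chart of `D` at `b`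
      have hwb : w ≠ D.pt 1 := fun h ↦ hwcl (by rw [h, ← h1]; exact frontier_subset_closure (D'.pt_mem_frontier 1))
      obtain ⟨χ⟩ := nonempty_hChart D.toJordanDomain (b := D.pt 1) (D.pt_mem_frontier 1)
      set z := χ.Ψinv w with hz
      have hz0 : 0 ≤ z.im := χ.mapsTo_inv ⟨hwD, hwb⟩
      have hzw : χ.Ψ z = w := χ.right_inv w ⟨hwD, hwb⟩
      -- a small ball around `z` whose upper part is mapped off `closure D'`
      have hopen : (closure D'.carrier)ᶜ ∈ 𝓝 (χ.Ψ z) := by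
        rw [hzw]; exact isClosed_closure.isOpen_compl.mem_nhds hwcl
      obtain ⟨r, hr, hball⟩ := Metric.mem_nhdsWithin_iff.1 ((χ.continuousOn z hz0).preimage_mem_nhdsWithin hopen)
      set N : Set ℂ := χ.Ψ '' (ball z r ∩ {y : ℂ | 0 < y.im}) with hN
      have hconv : Convex ℝ (ball z r ∩ {y : ℂ | 0 < y.im}) := (convex_ball z r).inter (convex_halfSpace_im_gt 0)
      refine ⟨N, (hconv.isPreconnected).image _ (χ.continuousOn.mono fun y hy ↦ show 0 ≤ y.im from le_of_lt
          hy.2), ?_, ?_, ?_⟩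
      · rintro _ ⟨y, ⟨hyb, hy0⟩, rfl⟩
        exact ⟨χ.apply_mem_carrier hy0, hball ⟨hyb, show 0 ≤ y.im from le_of_lt hy0⟩⟩
      · rw [← hzw]
        refine ContinuousWithinAt.mem_closure_image
          ((χ.continuousOn z hz0).mono fun y hy ↦ show 0 ≤ y.im from le_of_lt hy.2) ?_
        -- `z` is a limit of points of the upper part of the ball
        have htend : Tendsto (fun ε : ℝ ↦ z + (ε : ℂ) * I) (𝓝[>] 0) (𝓝 z) := by
          have : Continuous fun ε : ℝ ↦ z + (ε : ℂ) * I := by fun_prop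
          simpa using (this.tendsto 0).mono_left nhdsWithin_le_nhds
        refine mem_closure_of_tendsto htend ?_
        filter_upwards [Ioo_mem_nhdsGT hr] with ε hε
        refine ⟨?_, ?_⟩
        · rw [mem_ball, dist_eq_norm, add_sub_cancel_left, norm_mul, norm_I, mul_one, Complex.norm_real,
            Real.norm_of_nonneg hε.1.le]
          exact hε.2
        · show 0 < (z + (ε : ℂ) * I).im
          simp; linarith [hε.1]
      · have hmem : z + ((r / 2 : ℝ) : ℂ) * I ∈ ball z r ∩ {y : ℂ | 0 < y.im} := by
          refine ⟨?_, ?_⟩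
          · rw [mem_ball, dist_eq_norm, add_sub_cancel_left, norm_mul, norm_I, mul_one, Complex.norm_real,
              Real.norm_of_nonneg (by linarith)]
            linarith
          · show 0 < (z + ((r / 2 : ℝ) : ℂ) * I).im
            simp; linarith
        exact ⟨_, _, hmem, rfl⟩
  obtain ⟨q, hq⟩ := hwN.2
  obtain ⟨x, hx, hxw, H⟩ := exists_free_of_mem_diff hF hsub h0 h1 (hNsub hq).1 (hNsub hq).2
  obtain ⟨hgood, hcc, hmin⟩ := firstHit_spec xs hex ⟨hx, hxw⟩
  set n := Nat.find (hex x ⟨hx, hxw⟩) with hn_def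
  set e := d n hgood with he
  refine ⟨n, ⟨hgood, hmin⟩, ?_⟩
  -- `q ∈ e.U`, hence `N ⊆ e.U` and `w ∈ closure e.U`
  have hunion := e.hunion
  have hfrU := e.hfrU
  rw [hcc] at hunion hfrU
  have hqU : q ∈ e.U := H e.U e.U' e.s e.t e.hUo e.hU'o e.hdisj hunion hfrU e.hD'U
  have hNU : N ⊆ e.U := by
    have hNsub' : N ⊆ e.U ∪ e.U' := by
      rw [hunion]
      refine fun p hp ↦ ⟨(hNsub hp).1, ?_⟩
      rintro ⟨v, -, hvp⟩
      exact (hNsub hp).2 (hvp ▸ frontier_subset_closure (D'.boundary_mem_frontier v))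
    exact hNc.subset_left_of_subset_union e.hUo e.hU'o e.hdisj hNsub' ⟨q, hq, hqU⟩
  have hwU : w ∈ closure e.U := closure_mono hNU hwN.1
  rw [← e.hG4] at hwU
  obtain ⟨z, ⟨hz1, hz0⟩, rfl⟩ := hwU
  refine ⟨z, hz1, lt_of_le_of_ne hz0 fun him ↦ hwcl ?_, rfl⟩
  -- a model point on the base is mapped onto the closed free arc
  have hre : |z.re| ≤ 1 := by
    have := Complex.abs_re_le_norm z; linarith
  set u : ℝ := (1 - z.re) / 2 with hu
  have hu01 : u ∈ Icc (0 : ℝ) 1 := by rw [abs_le] at hre; exact ⟨by rw [hu]; linarith, by rw [hu]; linarith⟩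
  have hzb : z = bPar u := Complex.ext (by rw [(bPar_re_im u).1, hu]; ring) (by rw [(bPar_re_im u).2, ← him])
  rw [hzb, e.hG1 u hu01]
  exact frontier_subset_closure (D'.boundary_mem_frontier _)

include hF hsub h0 h1 in
/-- **Exhaustion**: a point in `closure (levelE t)` for every `t > 0` lies in `closure D'`. [folklore] -/
theorem levelE_exhaust {w : ℂ} (hw : ∀ t : ℝ, 0 < t → w ∈ closure (levelE xs d hex hF hsub h0 h1 t).carrier) :
    w ∈ closure D'.carrier := by
  by_contra hwcl
  have h18 : (0 : ℝ) < 1 / 8 ∧ (1 : ℝ) / 8 < 1 / 4 := by norm_num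
  have hwD : w ∈ closure D.carrier :=
    closure_mono (levelE_between xs d hex hF hsub h0 h1 _).2.1 (hw _ h18.1)
  obtain ⟨n, hn, z, hz1, hz0, hzw⟩ := exists_rep_of_notMem_closure xs d hex hF hsub h0 h1 hwD hwcl
  -- a small parameter at which `n` is treated and the level is below `im z`
  set t : ℝ := min (min (1 / 8) (z.im / 2)) (1 / ((n : ℝ) + 3)) with ht
  have hn3 : (0 : ℝ) < 1 / ((n : ℝ) + 3) := by positivity
  have ht0 : 0 < t := lt_min (lt_min (by norm_num) (by linarith)) hn3
  have ht4 : t < 1 / 4 := lt_of_le_of_lt ((min_le_left _ _).trans (min_le_left _ _)) (by norm_num)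
  have htz : t < z.im := lt_of_le_of_lt ((min_le_left _ _).trans (min_le_right _ _)) (by linarith)
  have htn : t < 1 / ((n : ℝ) + 2) := by
    refine lt_of_le_of_lt (min_le_right _ _) ?_
    exact one_div_lt_one_div_of_lt (by positivity) (by linarith)
  have hmem : n ∈ treated F (D'.mark 0) xs t := (mem_treated xs).2 ⟨lt_floor_of_lt ht0 htn, hn⟩
  have := G_notMem_closure_level xs d hex hF hsub h0 h1 ⟨ht0, ht4⟩ hmem hz1 htz
  rw [hzw] at this
  exact this (hw t ht0)

/-! ### Uniform convergence of the boundary loops -/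

include hF hsub h0 h1 in
/-- **The boundary loops converge uniformly to the boundary loop of `D'` as `t → 0⁺`.** [folklore] -/
theorem tendstoUniformly_levelE :
    TendstoUniformly (fun t ↦ (levelE xs d hex hF hsub h0 h1 t).boundary) D'.boundary (𝓝[>] 0) := by
  rw [Metric.tendstoUniformly_iff]
  intro ε hε
  obtain ⟨B, hBfin, hB⟩ := exists_finite_dist_lt hF hsub h0 h1 xs d hε
  -- conditions on `t`: small level, and every large good index treated with a fine collar
  have hsmall : ∀ᶠ t in 𝓝[>] (0 : ℝ), 0 < t ∧ t < 1 / 4 := by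
    filter_upwards [self_mem_nhdsWithin, mem_nhdsWithin_of_mem_nhds (Iio_mem_nhds (by norm_num : (0 : ℝ) < 1 / 4))]
      with t ht ht'
    exact ⟨ht, ht'⟩
  have hlarge : ∀ n ∈ B, ∀ᶠ t in 𝓝[>] (0 : ℝ), ∀ hn : xs n ∈ F ∧ xs n ∈ Ioo (D'.mark 0) (D'.mark 0 + 1),
      t < 1 / ((n : ℝ) + 2) ∧ ∀ p q : ℂ, ‖p‖ ≤ 1 → ‖q‖ ≤ 1 → ‖p - q‖ ≤ 6 * t → dist ((d n hn).G p) ((d n hn).G q)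
          < ε := by
    intro n _
    by_cases hn : xs n ∈ F ∧ xs n ∈ Ioo (D'.mark 0) (D'.mark 0 + 1)
    swap
    · exact Eventually.of_forall fun t hn' ↦ absurd hn' hn
    obtain ⟨δ, hδ, hδε⟩ := Metric.uniformContinuousOn_iff.1
      ((isCompact_closedBall (0 : ℂ) 1).uniformContinuousOn_of_continuous (d n hn).G.continuous.continuousOn) ε hε
    have h1' : Iio (1 / ((n : ℝ) + 2)) ∈ 𝓝[>] (0 : ℝ) := mem_nhdsWithin_of_mem_nhds (Iio_mem_nhds (by positivity))
    have h2' : Iio (δ / 7) ∈ 𝓝[>] (0 : ℝ) := mem_nhdsWithin_of_mem_nhds (Iio_mem_nhds (by positivity))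
    filter_upwards [h1', h2'] with t ht1 ht2 hn'
    refine ⟨ht1, fun p q hp hq hpq ↦ hδε p (mem_closedBall_zero_iff.2 hp) q (mem_closedBall_zero_iff.2 hq) ?_⟩
    rw [dist_eq_norm]
    have : t < δ / 7 := ht2
    linarith
  filter_upwards [hsmall, hBfin.eventually_all.2 hlarge] with t ht hBt θ
  obtain ⟨-, -, -, hbd⟩ := levelE_spec xs d hex hF hsub h0 h1 ht
  rw [hbd]
  set S := treated F (D'.mark 0) xs t with hS
  obtain ⟨-, -, -, -, -, -, hred⟩ := loopγ_facts xs d hex hF hsub h0 h1 ht.1 ht.2.le S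
  obtain ⟨y, hy, hγy, hwy⟩ := hred θ
  rw [hγy, hwy]
  by_cases h : y ∈ F ∧ y ∈ Ioo (D'.mark 0) (D'.mark 0 + 1)
  swap
  · rw [loopΓ_of_not xs d hex t S h, dist_self]; exact hε
  obtain ⟨hgood, hcc, hmin⟩ := firstHit_spec xs hex h
  set n := Nat.find (hex y h) with hn_def
  have hrep : (xs n ∈ F ∧ xs n ∈ Ioo (D'.mark 0) (D'.mark 0 + 1)) ∧
      ∀ k < n, xs k ∈ F ∧ xs k ∈ Ioo (D'.mark 0) (D'.mark 0 + 1) →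
        connectedComponentIn F (xs k) ≠ connectedComponentIn F (xs n) := ⟨hgood, hmin⟩
  obtain ⟨hcl, -, -, -⟩ := loopΓ_mem xs d hex hF hsub h0 h1 ht.1 ht.2.le S h
  obtain ⟨hccn, -, -, -, -, -, -, -⟩ := free_component hF h0 h1 hgood.1 hgood.2
  by_cases hnB : n ∈ B
  · -- a large component: treated, with a fine collar
    obtain ⟨htn, hcont⟩ := hBt n hnB hgood
    have hnS : n ∈ S := (mem_treated xs).2 ⟨lt_floor_of_lt ht.1 htn, hrep⟩
    have hxy : xs n ∈ connectedComponentIn F y := (Nat.find_spec (hex y h)).2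
    have hval : loopΓ xs d hex t S y = (d n hgood).G (modelPath t S n (relPos F y)) :=
      loopΓ_eq xs d hex t S h hgood hxy fun k hk hk' hkm ↦ hmin k hk hk' ((connectedComponentIn_eq
          hkm).symm.trans hcc.symm)
    obtain ⟨hu, hyeq⟩ := relPos_mem hF h0 h1 h
    have hu' : relPos F y ∈ Icc (0 : ℝ) 1 := ⟨hu.1.le, hu.2.le⟩
    have hwy' : D'.boundary y = (d n hgood).G (bPar (relPos F y)) := by
      rw [(d n hgood).hG1 _ hu', hcc, hyeq]
    have hpath : modelPath t S n (relPos F y) = pPar t (relPos F y) := by simp only [modelPath, if_pos hnS]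
    rw [hval, hwy', hpath, dist_comm]
    exact hcont _ _ (norm_pPar ht.1.le ht.2.le hu').2.1 (norm_bPar_le hu') (dist_pPar_bPar ht.1 ht.2.le hu')
  · -- a small component
    have hyθ : y ∈ Icc (sInf (connectedComponentIn F (xs n))) (sSup (connectedComponentIn F (xs n))) := by
      have : y ∈ connectedComponentIn F (xs n) := by rw [hcc]; exact mem_connectedComponentIn h.1
      rw [hccn] at this
      exact Ioo_subset_Icc_self this
    rw [dist_comm]
    exact hB n hrep hnB _ hcl y hyθ

end FamilyB

/-! ### The registered stub -/

/-- **Registered stub `stub_radoSqueezeFamily` (geometry F′ of composition 3 of the line `birth`) — Radó squeezes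
exist.** For Dobrushin domains `D' ⊆ D` with the same marked points there is a separated exhausting outer squeeze
`E : ℝ → DobrushinDomain` of `D'` inside `D` together with continuous maps `Φt t, Φ : ℂ → ℂ` agreeing on the open
unit disc with conformal equivalences onto `E t`, `D'`, sending `-1 ↦ a`, `1 ↦ b`, with `Φt t → Φ` uniformly on
the closed unit disc as `t → 0⁺`. Construction in the module docstrings of parts 1–13. [cite: PommerenkeBBCM1992,
Thm. 2.11] -/
theorem stub_radoSqueezeFamily :
    ∀ (D D' : DobrushinDomain), D'.carrier ⊆ D.carrier → D'.pt 0 = D.pt 0 → D'.pt 1 = D.pt 1 →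
      ∃ E : ℝ → DobrushinDomain,
        (∀ t : ℝ, 0 < t → D'.carrier ⊆ (E t).carrier ∧ (E t).carrier ⊆ D.carrier ∧
          (E t).pt 0 = D.pt 0 ∧ (E t).pt 1 = D.pt 1) ∧
        (∀ s t : ℝ, 0 < s → s < t → closure (E s).carrier ∩ closure (D.carrier \ (E t).carrier) = ∅) ∧
        (∀ γ : CurveClass ℂ, (∀ t : ℝ, 0 < t → γ.range ⊆ closure (E t).carrier) →
          γ.range ⊆ closure D'.carrier) ∧
        ∃ (Φt : ℝ → C(ℂ, ℂ)) (Φ : C(ℂ, ℂ)),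
          (∀ t : ℝ, 0 < t → ∃ g : ConformalEquiv (Metric.ball (0 : ℂ) 1) (E t).carrier,
            Set.EqOn (Φt t) g (Metric.ball (0 : ℂ) 1)) ∧
          (∃ g : ConformalEquiv (Metric.ball (0 : ℂ) 1) D'.carrier, Set.EqOn Φ g (Metric.ball (0 : ℂ) 1)) ∧
          (∀ t : ℝ, 0 < t → (E t).pt 0 = Φt t (-1) ∧ (E t).pt 1 = Φt t 1) ∧
          D'.pt 0 = Φ (-1) ∧ D'.pt 1 = Φ 1 ∧
          TendstoUniformlyOn (fun t => ((Φt t : C(ℂ, ℂ)) : ℂ → ℂ)) (Φ : ℂ → ℂ) (𝓝[>] (0 : ℝ))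
            (Metric.closedBall (0 : ℂ) 1) := by
  intro D D' hsub h0 h1
  classical
  set F : Set ℝ := {θ : ℝ | D'.boundary θ ∈ D.carrier} with hF
  -- a dense sequence of reals and the first hits
  set xs : ℕ → ℝ := fun n ↦ (((Denumerable.eqv ℚ).symm n : ℚ) : ℝ) with hxs_def
  have hxs : DenseRange xs :=
    Rat.denseRange_cast.comp (Denumerable.eqv ℚ).symm.surjective.denseRange Rat.continuous_coe_real
  have hex : ∀ y : ℝ, y ∈ F ∧ y ∈ Ioo (D'.mark 0) (D'.mark 0 + 1) →
      ∃ n : ℕ, (xs n ∈ F ∧ xs n ∈ Ioo (D'.mark 0) (D'.mark 0 + 1)) ∧ xs n ∈ connectedComponentIn F y := by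
    rintro y ⟨hy, hyw⟩
    obtain ⟨hcc, -, -, hl, hr, -, -, -⟩ := free_component hF h0 h1 hy hyw
    have hopen : IsOpen (connectedComponentIn F y) := (isOpen_free hF).connectedComponentIn
    obtain ⟨n, hn⟩ := hxs.exists_mem_open hopen ⟨y, mem_connectedComponentIn hy⟩
    refine ⟨n, ⟨connectedComponentIn_subset F y hn, ?_⟩, hn⟩
    have hn' : xs n ∈ Ioo (sInf (connectedComponentIn F y)) (sSup (connectedComponentIn F y)) := by
      rw [← hcc]; exact hn
    exact ⟨lt_of_le_of_lt hl hn'.1, lt_of_lt_of_le hn'.2 hr⟩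
  -- defect data
  have hd : ∀ n : ℕ, xs n ∈ F ∧ xs n ∈ Ioo (D'.mark 0) (D'.mark 0 + 1) → Nonempty (DefectData D D' F (xs n)) :=
    fun n hn ↦ nonempty_defectData hF hsub h0 h1 hn.1 hn.2
  set d : ∀ n : ℕ, xs n ∈ F ∧ xs n ∈ Ioo (D'.mark 0) (D'.mark 0 + 1) → DefectData D D' F (xs n) :=
    fun n hn ↦ Classical.choice (hd n hn) with hd_def
  set E : ℝ → DobrushinDomain := levelE xs d hex hF hsub h0 h1 with hE
  have hE1 : ∀ t : ℝ, 0 < t → D'.carrier ⊆ (E t).carrier ∧ (E t).carrier ⊆ D.carrier ∧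
      (E t).pt 0 = D.pt 0 ∧ (E t).pt 1 = D.pt 1 := fun t _ ↦ levelE_between xs d hex hF hsub h0 h1 t
  have hEb : TendstoUniformly (fun t ↦ (E t).boundary) D'.boundary (𝓝[>] 0) :=
    tendstoUniformly_levelE xs d hex hF hsub h0 h1
  refine ⟨E, hE1, fun s t hs hst ↦ levelE_separated xs d hex hF hsub h0 h1 hs hst,
    fun γ hγ w hw ↦ levelE_exhaust xs d hex hF hsub h0 h1 fun t ht ↦ hγ t ht hw, ?_⟩
  exact exists_discUniformizers_of_tendstoUniformly_boundary rfl rfl E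
    (fun t ht ↦ ⟨(hE1 t ht).1, (hE1 t ht).2.2.1.trans h0.symm, (hE1 t ht).2.2.2.trans h1.symm⟩) hEb

end Summit.CriticalPhenomena.SAWScalingLimit.Theorems.RestrictionOfLimit.Birth

end
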